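import Summits.HodgeConjecture.HodgeConjecture.Theorems.Ring2HypothesesDescentAbsolutePrimitiveMiddle
import Summits.HodgeConjecture.HodgeConjecture.Theorems.Ring2ClassTargetsRows
import HarnessLib

/-!
# Ring 2 — hypotheses layer, descent axis: ROW b06's primitive-middle form LAYER BY LAYER — the abelian-fourfold layer is Hodge
# for abelian fourfolds, so the first undecided layer is the SIXFOLD one (modulo (N)+(E)+(c) and `HCAtDim 4`, resp. Moonen–Zarhin
# + Markman)

HONEST FRAMING (page 1, verbatim the cell's standing line): **research route conditional on HC_CM; not a
corollary; Q11.4-sentence-2 already refuted in dim ≥ 3.** Nothing in this file proves a case of the Hodge conjecture;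
nothing discharges the binder of record b06 `Ring2.Hypotheses.AbsoluteHodgeImpliesAlgebraicAV` (`Ring2HypothesesDescent.lean`
:73; OPEN, `≡ HC_AV` modulo c1); the binder table's numbers do not move. `HC_CM` (`Theses.RankFourFaces.CMAbelianHodge`) does not
occur in this file; `HC_AV` is not asserted; `HCAtDim 4` (the Hodge conjecture for complex abelian FOURFOLDS) is a HYPOTHESIS,
obtained in §3 from the tree's named facts `MoonenZarhin1999_codimTwoHodgeClasses_abelianFourfold` (c32, refereed) and
`Markman2025_weilClasses_algebraic_abelianFourfold` (c28, CLAIMED IN PRINT — UNREFEREED PREPRINT arXiv:2502.03415; every arrow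
displaying it inherits that caveat), through `ClassTargets.hcAtDim_four_of_weilClassesFourfolds` (count once ab-spread-1's /
the hodge-weil ladder's).

Hodge ladder STAGE 3, `BINDER-OWNERS.md` row **b06**, seat `ring2-b06` (gen 72), fourth file of the gen. Gen 71's fourth file
gave ROW b06 `↔` "every Lefschetz-primitive absolute Hodge class in the middle degree `H^{2m}` of every complex abelian variety of
dimension `2m ≥ 4` is algebraic", first cell an abelian FOURFOLD. This file is the absolute twin of AbelianAll part XXIX
(`HC_AV_iff_hcAtDim_four_and_primitiveMiddle_ge_three`, ab-spread-1; count once THEIRS): an absolute Hodge class is a rational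
`(p,p)`-class (Charles–Schnell Def. 11.2.3 with `σ = id`), so the layer `m = 2` is an instance of `HCAtDim 4`, and

* §1 `absoluteHodge_algebraic_abelian_of_hcAtDim` (fact-free bookkeeping);
* §2 **`absoluteHodgeImpliesAlgebraicAV_iff_fourfolds_and_primitiveMiddle_ge_three_of_canonical`: ROW b06 `↔` (absolute Hodge
  classes on abelian FOURFOLDS are algebraic) ∧ (every primitive absolute Hodge class in the middle degree of every abelian variety
  of even dimension `2m ≥ 6` is algebraic)**, and **`absoluteHodgeImpliesAlgebraicAV_iff_primitiveMiddle_ge_three_of_hcAtDim_four`: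
  granted `HCAtDim 4`, ROW b06 `↔` its primitive-middle form FROM THE SIXFOLDS ON** (first cell: a primitive absolute Hodge class in
  `H⁶` of an abelian sixfold; by Moonen–Zarhin such a class not in the divisor span occurs only in Mumford–Tate-degenerate
  situations, e.g. Weil type) — with its `¬`-form;
* §3 the same keyed to c32 + c28 (`…_of_moonenZarhin_of_markman`).

HONEST COLUMN. Nothing is discharged; «10 · 0» unchanged; row b06, `HC_AV`, `HCAtDim 4` NOT asserted; (N), (E), (c), c32, c28 are
named facts displayed as hypotheses; no definition, no named fact, no sorry. NOT claimed: the analogous statement for the PARENT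
node (the Hodge conjecture for general fourfolds is not available), nor anything at `m = 3` itself.

References (bib keys): Deligne1982HodgeCycles (§2 Ex. 2.1 (c), (d) p. 16; Main Thm. 2.11), CharlesSchnell2014Notes (Def. 11.2.3,
Cor. 11.2.12), MoonenZarhin1999 (Thm. 0.1), Markman2025SecantWeil (Thm. 1.5.1), VoisinHodgeI2002 (§6.2.3 Def. 6.24, Thm. 6.25),
KerrPearlstein2011 (§3.3), BrosnanFangNiePearlstein2009 (§6 Lemma 48), Deligne2000 (§1). -/

noncomputable section

set_option linter.dupNamespace false

open CategoryTheory AlgebraicGeometry MonoidalCategory CartesianMonoidalCategory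
open Literature.AlgebraicTopology.SingularHomology Literature.Geometry.Kaehler
open Literature.AlgebraicGeometry Literature.AlgebraicGeometry.Motives
open Literature.AlgebraicGeometry.HodgeTheory
open Summit.HodgeConjecture.HodgeConjecture.Theorems
open Summit.HodgeConjecture.HodgeConjecture.Ring2.ClassTargets (HCAtDim hcAtDim_four_of_weilClassesFourfolds)

namespace Summit.HodgeConjecture.HodgeConjecture.Ring2.Hypotheses

/-! ## §1 Bookkeeping: absolute Hodge classes under `HCAtDim g` -/

/-- **Granted the Hodge conjecture for abelian `g`-folds, absolute Hodge classes on abelian `g`-folds are algebraic** (an absolute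
Hodge class is a rational `(p,p)`-class, `σ = id` in Charles–Schnell Def. 11.2.3). `HCAtDim g` is a hypothesis, NOT asserted.
[cite: CharlesSchnell2014Notes, Def. 11.2.3] [cite: Deligne2000, §1] -/
theorem absoluteHodge_algebraic_abelian_of_hcAtDim {g : ℕ} (h : HCAtDim g) (A : AbelianVariety ℂ) (hA : A.dim = g) (p : ℕ)
    (c : complexBetti A.X (2 * p)) (hc : IsAbsoluteHodgeClass A.dim A.X p c) : c ∈ algebraicClasses A.X p :=
  (h A hA).2 p c hc.isRationalClass hc.isOfHodgeType

/-! ## §2 Row b06 layer by layer: the fourfold layer and the layers `2m ≥ 6` (modulo (N)+(E)+(c)) -/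

/-- **ROW b06 `↔` (absolute Hodge classes on abelian FOURFOLDS are algebraic) ∧ (primitive absolute Hodge classes in the middle
degree of abelian varieties of even dimension `2m ≥ 6` are algebraic)** (modulo (N)+(E)+(c)): gen 71's primitive-middle form of
row b06 (`absoluteHodgeImpliesAlgebraicAV_iff_primitiveMiddle_of_canonical`) with its layer `m = 2` separated. Neither side is
asserted. [cite: Deligne1982HodgeCycles, §2 Example 2.1 (c), (d) (p. 16)] [cite: VoisinHodgeI2002, §6.2.3 Def. 6.24 and Thm. 6.25]
[cite: KerrPearlstein2011, §3.3] -/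
theorem absoluteHodgeImpliesAlgebraicAV_iff_fourfolds_and_primitiveMiddle_ge_three_of_canonical (hN : chartConjugation_canonical)
    (hex : ∀ ⦃n : ℕ⦄ ⦃X : SchemeOver ℂ⦄, IsSmoothProjective n X →
      ∀ (σ : ℂ ≃+* ℂ) (p : ℕ) (c : complexBetti X (2 * p)), ∃ s, IsConjugateClass σ X (2 * p) c s)
    (h21c : deligne1982_lefschetz_absoluteHodge_iff) :
    AbsoluteHodgeImpliesAlgebraicAV ↔
      (∀ (A : AbelianVariety ℂ), A.dim = 4 → ∀ (p : ℕ) (c : complexBetti A.X (2 * p)),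
          IsAbsoluteHodgeClass A.dim A.X p c → c ∈ algebraicClasses A.X p) ∧
        ∀ (A : AbelianVariety ℂ) (Λ : HardLefschetzNFold A.dim A.X) (m : ℕ), 3 ≤ m → A.dim = 2 * m →
          ∀ c : complexBetti A.X (2 * m), IsAbsoluteHodgeClass A.dim A.X m c →
            c ∈ primitiveClasses Λ.hyperplaneClass A.dim (2 * m) → c ∈ algebraicClasses A.X m := by
  refine ⟨fun h ↦ ⟨fun A _ p c hc ↦ h A p c hc, fun A _ m _ _ c hc _ ↦ h A m c hc⟩,
    fun h ↦ (absoluteHodgeImpliesAlgebraicAV_iff_primitiveMiddle_of_canonical hN hex h21c).2 ?_⟩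
  intro A Λ m h2 hA c hc hprim
  by_cases hm : m = 2
  · subst hm
    exact h.1 A hA 2 c hc
  · exact h.2 A Λ m (by omega) hA c hc hprim

/-- **GRANTED `HCAtDim 4`, ROW b06 `↔` "every Lefschetz-PRIMITIVE absolute Hodge class in the MIDDLE degree `H^{2m}` of every
complex abelian variety of dimension `2m ≥ 6` is algebraic"** (modulo (N)+(E)+(c)): the fourfold layer of the previous theorem is
an instance of the Hodge conjecture for abelian fourfolds (§1). First cell with content: a primitive absolute Hodge class in `H⁶`
of an abelian SIXFOLD. The absolute twin of AbelianAll XXIX `HC_AV_iff_primitiveMiddle_ge_three_of_hcAtDim_four` (count once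
THEIRS). `HCAtDim 4` and row b06 are NOT asserted. [cite: Deligne1982HodgeCycles, §2 Example 2.1 (c), (d) (p. 16)]
[cite: MoonenZarhin1999, Thm. 0.1] [cite: KerrPearlstein2011, §3.3] [cite: Deligne2000, §1] -/
theorem absoluteHodgeImpliesAlgebraicAV_iff_primitiveMiddle_ge_three_of_hcAtDim_four (hN : chartConjugation_canonical)
    (hex : ∀ ⦃n : ℕ⦄ ⦃X : SchemeOver ℂ⦄, IsSmoothProjective n X →
      ∀ (σ : ℂ ≃+* ℂ) (p : ℕ) (c : complexBetti X (2 * p)), ∃ s, IsConjugateClass σ X (2 * p) c s)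
    (h21c : deligne1982_lefschetz_absoluteHodge_iff) (h4 : HCAtDim 4) :
    AbsoluteHodgeImpliesAlgebraicAV ↔
      ∀ (A : AbelianVariety ℂ) (Λ : HardLefschetzNFold A.dim A.X) (m : ℕ), 3 ≤ m → A.dim = 2 * m →
        ∀ c : complexBetti A.X (2 * m), IsAbsoluteHodgeClass A.dim A.X m c →
          c ∈ primitiveClasses Λ.hyperplaneClass A.dim (2 * m) → c ∈ algebraicClasses A.X m :=
  (absoluteHodgeImpliesAlgebraicAV_iff_fourfolds_and_primitiveMiddle_ge_three_of_canonical hN hex h21c).trans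
    ⟨fun h ↦ h.2, fun h ↦ ⟨fun A hA p c hc ↦ absoluteHodge_algebraic_abelian_of_hcAtDim h4 A hA p c hc, h⟩⟩

/-- **The `¬`-form: granted `HCAtDim 4`, a counterexample to row b06, if any, can be taken Lefschetz-primitive in the middle degree
of an abelian variety of even dimension `2m ≥ 6`** (modulo (N)+(E)+(c)). Nothing asserted. [cite: Deligne1982HodgeCycles, §2 Example 2.1 (c), (d) (p. 16)]
[cite: KerrPearlstein2011, §3.3] -/
theorem not_absoluteHodgeImpliesAlgebraicAV_iff_exists_primitiveMiddle_ge_three_of_hcAtDim_four (hN : chartConjugation_canonical)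
    (hex : ∀ ⦃n : ℕ⦄ ⦃X : SchemeOver ℂ⦄, IsSmoothProjective n X →
      ∀ (σ : ℂ ≃+* ℂ) (p : ℕ) (c : complexBetti X (2 * p)), ∃ s, IsConjugateClass σ X (2 * p) c s)
    (h21c : deligne1982_lefschetz_absoluteHodge_iff) (h4 : HCAtDim 4) :
    ¬ AbsoluteHodgeImpliesAlgebraicAV ↔
      ∃ (A : AbelianVariety ℂ) (Λ : HardLefschetzNFold A.dim A.X) (m : ℕ), 3 ≤ m ∧ A.dim = 2 * m ∧
        ∃ c : complexBetti A.X (2 * m), IsAbsoluteHodgeClass A.dim A.X m c ∧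
          c ∈ primitiveClasses Λ.hyperplaneClass A.dim (2 * m) ∧ c ∉ algebraicClasses A.X m := by
  rw [absoluteHodgeImpliesAlgebraicAV_iff_primitiveMiddle_ge_three_of_hcAtDim_four hN hex h21c h4]
  push Not
  exact Iff.rfl

/-! ## §3 Keyed to Moonen–Zarhin (c32) and Markman's fourfold statement (c28, unrefereed preprint) -/

/-- **Granted Moonen–Zarhin 1999 (c32) and Markman's fourfold Weil-class statement (c28, CLAIMED IN PRINT — UNREFEREED PREPRINT),
ROW b06 `↔` its primitive-middle form from the SIXFOLDS on** (modulo (N)+(E)+(c)): `HCAtDim 4` from the two facts by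
`ClassTargets.hcAtDim_four_of_weilClassesFourfolds` (count once ab-spread-1's / the hodge-weil ladder's). Neither the facts nor row
b06 are asserted. [cite: MoonenZarhin1999, Thm. 0.1] [cite: Markman2025SecantWeil, Thm. 1.5.1]
[cite: Deligne1982HodgeCycles, §2 Example 2.1 (c), (d) (p. 16)] -/
theorem absoluteHodgeImpliesAlgebraicAV_iff_primitiveMiddle_ge_three_of_moonenZarhin_of_markman
    (hN : chartConjugation_canonical)
    (hex : ∀ ⦃n : ℕ⦄ ⦃X : SchemeOver ℂ⦄, IsSmoothProjective n X →
      ∀ (σ : ℂ ≃+* ℂ) (p : ℕ) (c : complexBetti X (2 * p)), ∃ s, IsConjugateClass σ X (2 * p) c s)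
    (h21c : deligne1982_lefschetz_absoluteHodge_iff) (h01 : MoonenZarhin1999_codimTwoHodgeClasses_abelianFourfold)
    (hW : Markman2025_weilClasses_algebraic_abelianFourfold) :
    AbsoluteHodgeImpliesAlgebraicAV ↔
      ∀ (A : AbelianVariety ℂ) (Λ : HardLefschetzNFold A.dim A.X) (m : ℕ), 3 ≤ m → A.dim = 2 * m →
        ∀ c : complexBetti A.X (2 * m), IsAbsoluteHodgeClass A.dim A.X m c →
          c ∈ primitiveClasses Λ.hyperplaneClass A.dim (2 * m) → c ∈ algebraicClasses A.X m :=
  absoluteHodgeImpliesAlgebraicAV_iff_primitiveMiddle_ge_three_of_hcAtDim_four hN hex h21c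
    (hcAtDim_four_of_weilClassesFourfolds h01 hW)

/-- **The same keyed to (N), (G), (c), c32, c28** ((E) from Grothendieck's comparison fact (G)). None of the five facts is asserted;
row b06 is NOT asserted. [cite: CharlesSchnell2014Notes, §11.2.2 (11.2.1)–(11.2.3)] [cite: MoonenZarhin1999, Thm. 0.1]
[cite: Markman2025SecantWeil, Thm. 1.5.1] -/
theorem absoluteHodgeImpliesAlgebraicAV_iff_primitiveMiddle_ge_three_of_grothendieck_of_moonenZarhin_of_markman
    (hN : chartConjugation_canonical) (hG : grothendieck_comparison_realize_surjective)
    (h21c : deligne1982_lefschetz_absoluteHodge_iff) (h01 : MoonenZarhin1999_codimTwoHodgeClasses_abelianFourfold)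
    (hW : Markman2025_weilClasses_algebraic_abelianFourfold) :
    AbsoluteHodgeImpliesAlgebraicAV ↔
      ∀ (A : AbelianVariety ℂ) (Λ : HardLefschetzNFold A.dim A.X) (m : ℕ), 3 ≤ m → A.dim = 2 * m →
        ∀ c : complexBetti A.X (2 * m), IsAbsoluteHodgeClass A.dim A.X m c →
          c ∈ primitiveClasses Λ.hyperplaneClass A.dim (2 * m) → c ∈ algebraicClasses A.X m :=
  absoluteHodgeImpliesAlgebraicAV_iff_primitiveMiddle_ge_three_of_moonenZarhin_of_markman hN
    (exists_isConjugateClass_even_of_grothendieck hG) h21c h01 hW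

/-! ## Audit: nothing is decided here

No theorem above concludes `AbsoluteHodgeImpliesAlgebraicAV`, `HC_AV`, `HCAtDim 4` or `HC_CM` outright: every statement carries the
undischarged hypotheses (N), (E)/(G), (c) and `HCAtDim 4` / c32 + c28 (named facts of the tree, displayed, never asserted). Axiom
closures: the three standard axioms. -/

#print axioms Summit.HodgeConjecture.HodgeConjecture.Ring2.Hypotheses.absoluteHodgeImpliesAlgebraicAV_iff_primitiveMiddle_ge_three_of_hcAtDim_four
#print axioms Summit.HodgeConjecture.HodgeConjecture.Ring2.Hypotheses.absoluteHodgeImpliesAlgebraicAV_iff_primitiveMiddle_ge_three_of_moonenZarhin_of_markman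

end Summit.HodgeConjecture.HodgeConjecture.Ring2.Hypotheses

end
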